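import Mathlib.NumberTheory.EulerProduct.Basic
import Mathlib.NumberTheory.Harmonic.Bounds
import Mathlib.Analysis.SpecialFunctions.Pow.Real
import Literature.NumberTheory.LFunctions.MertensElementary
import Literature.NumberTheory.Sieve.SieveFramework
import HarnessLib

/-!
# Elementary lemmas for Bombieri's asymptotic sieve: Mertens quotients, rough numbers, tails

Topic `Literature/NumberTheory/Sieve`, companion file of `BombieriAsymptoticSieve.lean`
([BombieriRIMS1977], [FriedlanderIwaniecPisa1978]); source-independent tools used in the proofs
of [FriedlanderIwaniecPisa1978] Lemmata 6–9 (`K = ℚ`), all PROVED here: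

* `log_le_prod_primesBelow_inv`, `prod_primesBelow_one_sub_inv_le`: Mertens' elementary
  `∏_{p<z} (1 − 1/p) ≤ 1/log z` (Euler product over `z`-smooth numbers,
  Mathlib's `EulerProduct.summable_and_hasSum_smoothNumbers_prod_primesBelow_tsum`, and
  `log_add_one_le_harmonic`) — the "well-known latter half" of [FriedlanderIwaniecPisa1978]
  Lemma 7;
* `prod_primesGe_one_sub_inv_inv_le`, `prod_primesGe_one_add_inv_le`: the quotient bounds
  `∏_{z ≤ p ≤ x} (1 − 1/p)⁻¹, ∏_{z ≤ p ≤ x} (1 + 1/p) ≤ e⁵ log x / log z` (with the tree's lower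
  bound `Literature.NumberTheory.LFunctions.MertensBound.exp_neg_div_log_le_prod_one_sub_inv`);
* `sum_le_prod_tsum_of_factored`, `mem_factoredNumbers_of_rough`, `sum_inv_rough_le`: sums of a
  nonnegative multiplicative function over the `z`-rough integers `d ≤ x` (`(d, P(z)) = 1`) are
  bounded by the Euler product over the primes of `[z, x]` (Mathlib's
  `EulerProduct.summable_and_hasSum_factoredNumbers_prod_filter_prime_tsum`); in particular
  `∑_{d ≤ x, (d,P(z))=1} 1/d ≤ e⁵ log x / log z` ([FriedlanderIwaniecPisa1978] Lemma 8 for the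
  integers);
* `abs_log_one_add_le`, `abs_exp_sub_one_le`, `abs_log_factor_le`: `|log(1+u)| ≤ 2|u|`
  (`|u| ≤ 1/2`), `|e^x − 1| ≤ |x| e^{|x|}`, and the Euler-factor logarithm bound;
* `abs_tsum_sub_sum_range_le`, `sum_abs_le_of_le_mem`: tails `∑_{n ≥ N} |t n| ≤ N^{−η} ∑ |t n| n^η`;
* `sum_primesBelow_eq_sum_range`, `le_of_rough` (a rough `δ ∉ {0, 1}` is `≥ z`).

No new definitions; the primes of `[z, x]` are written `(Nat.primesLE ⌊x⌋₊).filter (z ≤ ·)`.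
-/

noncomputable section

open Filter Finset
open scoped Topology

namespace Literature.NumberTheory.Sieve

namespace BombieriSieve

/-! ### Mertens: `∏_{p<z} (1 − 1/p) ≤ 1/log z` -/

/-- `log N ≤ ∏_{p < N} (1 − 1/p)⁻¹`: every `1 ≤ n < N` is `N`-smooth, so the Euler product over
`p < N` of the geometric series `∑_e p^{−e}` (Mathlib's
`EulerProduct.summable_and_hasSum_smoothNumbers_prod_primesBelow_tsum`) dominates the harmonic
sum `∑_{n < N} 1/n`, which dominates `log N` (`log_add_one_le_harmonic`). [folklore] -/
theorem log_le_prod_primesBelow_inv {N : ℕ} (hN : 1 ≤ N) :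
    Real.log N ≤ ∏ p ∈ Nat.primesBelow N, (1 - (p : ℝ)⁻¹)⁻¹ := by
  set f : ℕ → ℝ := fun n => (n : ℝ)⁻¹ with hf
  have hf₁ : f 1 = 1 := by simp [hf]
  have hmul : ∀ {m n : ℕ}, Nat.Coprime m n → f (m * n) = f m * f n := by
    intro m n _
    show ((m * n : ℕ) : ℝ)⁻¹ = (m : ℝ)⁻¹ * (n : ℝ)⁻¹
    rw [Nat.cast_mul, mul_inv]
  have hgeom_summ : ∀ {p : ℕ}, p.Prime → Summable (fun n : ℕ => ‖f (p ^ n)‖) := by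
    intro p hp
    have hp0 : (0 : ℝ) ≤ (p : ℝ)⁻¹ := inv_nonneg.mpr (Nat.cast_nonneg p)
    have hp1 : (p : ℝ)⁻¹ < 1 := inv_lt_one_of_one_lt₀ (by exact_mod_cast hp.one_lt)
    refine (summable_geometric_of_lt_one hp0 hp1).congr fun n => ?_
    simp [hf, inv_pow]
  obtain ⟨-, hhas⟩ :=
    EulerProduct.summable_and_hasSum_smoothNumbers_prod_primesBelow_tsum hf₁ hmul hgeom_summ N
  have hgeom : ∀ p ∈ Nat.primesBelow N, ∑' n : ℕ, f (p ^ n) = (1 - (p : ℝ)⁻¹)⁻¹ := by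
    intro p hp
    have hp' := Nat.prime_of_mem_primesBelow hp
    have hp0 : (0 : ℝ) ≤ (p : ℝ)⁻¹ := inv_nonneg.mpr (Nat.cast_nonneg p)
    have hp1 : (p : ℝ)⁻¹ < 1 := inv_lt_one_of_one_lt₀ (by exact_mod_cast hp'.one_lt)
    rw [← tsum_geometric_of_lt_one hp0 hp1]
    exact tsum_congr fun n => by simp [hf, inv_pow]
  rw [← Finset.prod_congr rfl hgeom]
  have hmem : ∀ n ∈ Finset.Icc 1 (N - 1), n ∈ N.smoothNumbers := fun n hn => by
    obtain ⟨h1, h2⟩ := Finset.mem_Icc.mp hn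
    exact Nat.mem_smoothNumbers_of_lt h1 (by omega)
  have hle := sum_le_hasSum ((Finset.Icc 1 (N - 1)).subtype (· ∈ N.smoothNumbers))
    (fun m _ => inv_nonneg.mpr (Nat.cast_nonneg _)) hhas
  rw [Finset.sum_subtype_of_mem f hmem] at hle
  refine le_trans ?_ hle
  have hharm : ∑ n ∈ Finset.Icc 1 (N - 1), f n = ((harmonic (N - 1) : ℚ) : ℝ) := by
    rw [harmonic_eq_sum_Icc]
    push_cast
    rfl
  rw [hharm]
  have := log_add_one_le_harmonic (N - 1)
  rwa [Nat.sub_add_cancel hN] at this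

/-- **Mertens-type upper bound** `∏_{p < z} (1 − 1/p) ≤ 1/log z` for real `z > 1` (the "latter
half" of [FriedlanderIwaniecPisa1978] Lemma 7, "being well-known"). [folklore] -/
theorem prod_primesBelow_one_sub_inv_le {z : ℝ} (hz : 1 < z) :
    ∏ p ∈ Nat.primesBelow ⌈z⌉₊, (1 - (p : ℝ)⁻¹) ≤ 1 / Real.log z := by
  have hz0 : 0 < z := by linarith
  have hN : 1 ≤ ⌈z⌉₊ := Nat.one_le_iff_ne_zero.mpr (Nat.ceil_pos.mpr hz0).ne'
  have hlogz : 0 < Real.log z := Real.log_pos hz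
  have hlogN : Real.log z ≤ Real.log (⌈z⌉₊ : ℝ) := Real.log_le_log hz0 (Nat.le_ceil z)
  have h := log_le_prod_primesBelow_inv hN
  rw [Finset.prod_inv_distrib] at h
  rw [one_div, ← inv_inv (∏ p ∈ Nat.primesBelow ⌈z⌉₊, (1 - (p : ℝ)⁻¹))]
  exact (inv_anti₀ (hlogz.trans_le hlogN) h).trans (inv_anti₀ hlogz hlogN)

/-! ### The primes of the interval `[z, x]` and Mertens' quotient bound -/

/-- Membership in the set of primes `p` with `z ≤ p ≤ ⌊x⌋`. [folklore] -/
theorem mem_primesGe {z x : ℝ} {p : ℕ} :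
    p ∈ (Nat.primesLE ⌊x⌋₊).filter (fun p : ℕ => z ≤ (p : ℝ)) ↔ p.Prime ∧ z ≤ (p : ℝ) ∧ p ≤ ⌊x⌋₊ := by
  rw [Finset.mem_filter, Nat.mem_primesLE]
  tauto

/-- **Mertens' quotient bound**: `∏_{z ≤ p ≤ x} (1 − 1/p)⁻¹ ≤ e⁵ log x / log z` for `2 ≤ z ≤ x`
(from `∏_{p<z}(1 − 1/p) ≤ 1/log z` and the tree's `∏_{p ≤ N}(1 − 1/p) ≥ e^{−5}/log N`).
[folklore] -/
theorem prod_primesGe_one_sub_inv_inv_le {z x : ℝ} (hz : 2 ≤ z) (hzx : z ≤ x) :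
    ∏ p ∈ (Nat.primesLE ⌊x⌋₊).filter (fun p : ℕ => z ≤ (p : ℝ)), (1 - (p : ℝ)⁻¹)⁻¹ ≤ Real.exp 5 * Real.log x / Real.log z := by
  have hx2 : (2 : ℝ) ≤ x := hz.trans hzx
  have hx0 : 0 < x := by linarith
  have hN2 : 2 ≤ ⌊x⌋₊ := Nat.le_floor (by exact_mod_cast hx2)
  have hz1 : 1 < z := by linarith
  have hlogz : 0 < Real.log z := Real.log_pos hz1
  have hlogx : 0 < Real.log x := Real.log_pos (by linarith)
  -- split the product over `p ≤ ⌊x⌋` at `z`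
  have hsplit : ∏ p ∈ Nat.primesLE ⌊x⌋₊, (1 - (p : ℝ)⁻¹) =
      (∏ p ∈ Nat.primesBelow ⌈z⌉₊, (1 - (p : ℝ)⁻¹)) * ∏ p ∈ (Nat.primesLE ⌊x⌋₊).filter (fun p : ℕ => z ≤ (p : ℝ)), (1 - (p : ℝ)⁻¹) := by
    rw [← Finset.prod_filter_mul_prod_filter_not (Nat.primesLE ⌊x⌋₊)
      (fun p : ℕ => z ≤ (p : ℝ)), mul_comm]
    congr 1
    refine Finset.prod_congr ?_ fun _ _ => rfl
    ext p
    simp only [Finset.mem_filter, Nat.mem_primesLE, Nat.mem_primesBelow, not_le, Nat.lt_ceil]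
    constructor
    · rintro ⟨⟨-, hp⟩, hpz⟩
      exact ⟨hpz, hp⟩
    · rintro ⟨hpz, hp⟩
      refine ⟨⟨?_, hp⟩, hpz⟩
      have : (p : ℝ) ≤ x := by linarith
      exact Nat.le_floor this
  have hpos : ∀ p : ℕ, p.Prime → 0 < 1 - (p : ℝ)⁻¹ := fun p hp =>
    sub_pos.mpr (inv_lt_one_of_one_lt₀ (by exact_mod_cast hp.one_lt))
  have hPz_pos : 0 < ∏ p ∈ Nat.primesBelow ⌈z⌉₊, (1 - (p : ℝ)⁻¹) :=
    Finset.prod_pos fun p hp => hpos p (Nat.prime_of_mem_primesBelow hp)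
  have hPI_pos : 0 < ∏ p ∈ (Nat.primesLE ⌊x⌋₊).filter (fun p : ℕ => z ≤ (p : ℝ)), (1 - (p : ℝ)⁻¹) :=
    Finset.prod_pos fun p hp => hpos p (mem_primesGe.mp hp).1
  have hlow := Literature.NumberTheory.LFunctions.MertensBound.exp_neg_div_log_le_prod_one_sub_inv ⌊x⌋₊ hN2
  simp only [one_div] at hlow
  rw [hsplit] at hlow
  have hPz := prod_primesBelow_one_sub_inv_le hz1
  -- `e^{-5}/log ⌊x⌋ ≤ P(z) · Q` with `P(z) ≤ 1/log z` gives `Q⁻¹ ≤ e^5 log ⌊x⌋ / log z ≤ …`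
  have hlogfx : Real.log (⌊x⌋₊ : ℝ) ≤ Real.log x :=
    Real.log_le_log (by exact_mod_cast (by omega : 0 < ⌊x⌋₊)) (Nat.floor_le hx0.le)
  have hlogfx0 : 0 < Real.log (⌊x⌋₊ : ℝ) := Real.log_pos (by exact_mod_cast (by omega : 1 < ⌊x⌋₊))
  rw [Finset.prod_inv_distrib, inv_le_iff_one_le_mul₀ hPI_pos]
  -- goal: 1 ≤ (e^5 log x / log z) * Q
  have h1 : Real.exp (-5) / Real.log (⌊x⌋₊ : ℝ) ≤ (1 / Real.log z) * ∏ p ∈ (Nat.primesLE ⌊x⌋₊).filter (fun p : ℕ => z ≤ (p : ℝ)), (1 - (p : ℝ)⁻¹) :=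
    hlow.trans (mul_le_mul_of_nonneg_right hPz hPI_pos.le)
  rw [div_le_iff₀ hlogfx0] at h1
  have h2 : Real.exp (-5) * Real.exp 5 = 1 := by rw [← Real.exp_add]; norm_num
  calc (1 : ℝ) = Real.exp (-5) * Real.exp 5 := h2.symm
    _ ≤ ((1 / Real.log z) * (∏ p ∈ (Nat.primesLE ⌊x⌋₊).filter (fun p : ℕ => z ≤ (p : ℝ)), (1 - (p : ℝ)⁻¹)) * Real.log (⌊x⌋₊ : ℝ)) *
          Real.exp 5 := by gcongr
    _ ≤ ((1 / Real.log z) * (∏ p ∈ (Nat.primesLE ⌊x⌋₊).filter (fun p : ℕ => z ≤ (p : ℝ)), (1 - (p : ℝ)⁻¹)) * Real.log x) *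
          Real.exp 5 := by gcongr
    _ = Real.exp 5 * Real.log x / Real.log z * ∏ p ∈ (Nat.primesLE ⌊x⌋₊).filter (fun p : ℕ => z ≤ (p : ℝ)), (1 - (p : ℝ)⁻¹) := by
          field_simp

/-- `∏_{z ≤ p ≤ x} (1 + 1/p) ≤ e⁵ log x / log z` (`(1 + 1/p)(1 − 1/p) ≤ 1`). [folklore] -/
theorem prod_primesGe_one_add_inv_le {z x : ℝ} (hz : 2 ≤ z) (hzx : z ≤ x) :
    ∏ p ∈ (Nat.primesLE ⌊x⌋₊).filter (fun p : ℕ => z ≤ (p : ℝ)), (1 + (p : ℝ)⁻¹) ≤ Real.exp 5 * Real.log x / Real.log z := by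
  refine le_trans ?_ (prod_primesGe_one_sub_inv_inv_le hz hzx)
  refine Finset.prod_le_prod (fun p _ => by positivity) fun p hp => ?_
  have hp := (mem_primesGe.mp hp).1
  have hq : 0 < 1 - (p : ℝ)⁻¹ := sub_pos.mpr (inv_lt_one_of_one_lt₀ (by exact_mod_cast hp.one_lt))
  rw [inv_eq_one_div (1 - (p : ℝ)⁻¹), le_div_iff₀ hq]
  nlinarith [sq_nonneg ((p : ℝ)⁻¹)]

/-! ### Sums over `z`-rough numbers via Euler products -/

/-- A nonnegative multiplicative `h` with `h(1) = 1` and `∑_e h(p^e) < ∞` at each prime: for a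
finite set `D` of numbers all of whose prime factors lie in the finite set of primes `s`,
`∑_{d ∈ D} h(d) ≤ ∏_{p ∈ s} ∑_e h(p^e)` (Mathlib's Euler product over `s`-factored numbers).
[folklore] -/
theorem sum_le_prod_tsum_of_factored {h : ℕ → ℝ} (h1 : h 1 = 1)
    (hmul : ∀ {m n : ℕ}, Nat.Coprime m n → h (m * n) = h m * h n) (h0 : ∀ n, 0 ≤ h n)
    (hsum : ∀ {p : ℕ}, p.Prime → Summable (fun e : ℕ => h (p ^ e)))
    {s : Finset ℕ} (hs : ∀ p ∈ s, p.Prime) {D : Finset ℕ}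
    (hD : ∀ d ∈ D, d ∈ Nat.factoredNumbers s) :
    ∑ d ∈ D, h d ≤ ∏ p ∈ s, ∑' e : ℕ, h (p ^ e) := by
  have hsum' : ∀ {p : ℕ}, p.Prime → Summable (fun e : ℕ => ‖h (p ^ e)‖) := fun hp =>
    (hsum hp).congr fun e => (Real.norm_of_nonneg (h0 _)).symm
  obtain ⟨-, hhas⟩ :=
    EulerProduct.summable_and_hasSum_factoredNumbers_prod_filter_prime_tsum h1 hmul hsum' s
  rw [Finset.filter_true_of_mem hs] at hhas
  have hle := sum_le_hasSum (D.subtype (· ∈ Nat.factoredNumbers s)) (fun m _ => h0 _) hhas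
  rwa [Finset.sum_subtype_of_mem h hD] at hle

/-- The `z`-rough numbers `d ≤ x` (`(d, P(z)) = 1`, `1 ≤ d ≤ ⌊x⌋`) are `(Nat.primesLE ⌊x⌋₊).filter (fun p : ℕ => z ≤ (p : ℝ))`-factored.
[folklore] -/
theorem mem_factoredNumbers_of_rough {z x : ℝ} {d : ℕ}
    (hd : d ∈ (Finset.Ioc 0 ⌊x⌋₊).filter (fun d : ℕ => d.Coprime (primesProdBelow z))) :
    d ∈ Nat.factoredNumbers ((Nat.primesLE ⌊x⌋₊).filter (fun p : ℕ => z ≤ (p : ℝ))) := by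
  obtain ⟨hd, hcop⟩ := Finset.mem_filter.mp hd
  obtain ⟨hd0, hdx⟩ := Finset.mem_Ioc.mp hd
  rw [Nat.mem_factoredNumbers']
  intro p hp hpd
  rw [mem_primesGe]
  refine ⟨hp, ?_, (Nat.le_of_dvd hd0 hpd).trans hdx⟩
  by_contra hlt
  rw [not_le] at hlt
  have h1 : p ∣ primesProdBelow z := (dvd_primesProdBelow_iff hp z).mpr hlt
  have h2 : ¬ p ∣ primesProdBelow z :=
    hp.coprime_iff_not_dvd.mp (Nat.Coprime.coprime_dvd_left hpd hcop)
  exact h2 h1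

/-- `∑_{d ≤ x, (d, P(z)) = 1} 1/d ≤ ∏_{z ≤ p ≤ x} (1 − 1/p)⁻¹ ≤ e⁵ log x / log z` for `2 ≤ z ≤ x`
([FriedlanderIwaniecPisa1978] Lemma 8 for the sequence of all integers). [folklore] -/
theorem sum_inv_rough_le {z x : ℝ} (hz : 2 ≤ z) (hzx : z ≤ x) :
    ∑ d ∈ (Finset.Ioc 0 ⌊x⌋₊).filter (fun d : ℕ => d.Coprime (primesProdBelow z)), (d : ℝ)⁻¹ ≤
      Real.exp 5 * Real.log x / Real.log z := by
  refine le_trans ?_ (prod_primesGe_one_sub_inv_inv_le hz hzx)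
  have hgeom : ∀ {p : ℕ}, p.Prime → HasSum (fun e : ℕ => ((p ^ e : ℕ) : ℝ)⁻¹) (1 - (p : ℝ)⁻¹)⁻¹ := by
    intro p hp
    have hp0 : (0 : ℝ) ≤ (p : ℝ)⁻¹ := inv_nonneg.mpr (Nat.cast_nonneg p)
    have hp1 : (p : ℝ)⁻¹ < 1 := inv_lt_one_of_one_lt₀ (by exact_mod_cast hp.one_lt)
    refine (hasSum_geometric_of_lt_one hp0 hp1).congr_fun fun e => ?_
    push_cast
    rw [inv_pow]
  calc ∑ d ∈ (Finset.Ioc 0 ⌊x⌋₊).filter (fun d : ℕ => d.Coprime (primesProdBelow z)), (d : ℝ)⁻¹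
      ≤ ∏ p ∈ (Nat.primesLE ⌊x⌋₊).filter (fun p : ℕ => z ≤ (p : ℝ)), ∑' e : ℕ, ((p ^ e : ℕ) : ℝ)⁻¹ :=
        sum_le_prod_tsum_of_factored (h := fun n : ℕ => (n : ℝ)⁻¹) (by simp)
          (fun {m n} _ => by push_cast; rw [mul_inv]) (fun n => inv_nonneg.mpr (Nat.cast_nonneg n))
          (fun hp => (hgeom hp).summable) (fun p hp => (mem_primesGe.mp hp).1)
          (fun d hd => mem_factoredNumbers_of_rough hd)
    _ = ∏ p ∈ (Nat.primesLE ⌊x⌋₊).filter (fun p : ℕ => z ≤ (p : ℝ)), (1 - (p : ℝ)⁻¹)⁻¹ :=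
        Finset.prod_congr rfl fun p hp => (hgeom (mem_primesGe.mp hp).1).tsum_eq

/-! ### Two elementary inequalities -/

/-- `|log (1 + u)| ≤ 2|u|` for `|u| ≤ 1/2` (from `1 − 1/x ≤ log x ≤ x − 1`). [folklore] -/
theorem abs_log_one_add_le {u : ℝ} (hu : |u| ≤ 1 / 2) : |Real.log (1 + u)| ≤ 2 * |u| := by
  have hu' := abs_le.mp hu
  have hpos : 0 < 1 + u := by linarith
  have hne : 1 + u ≠ 0 := hpos.ne'
  rw [abs_le]
  constructor
  · have h1 := Real.one_sub_inv_le_log_of_pos hpos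
    have h2 : -(2 * |u|) ≤ 1 - (1 + u)⁻¹ := by
      have e : 1 - (1 + u)⁻¹ = u / (1 + u) := by field_simp; ring
      rw [e, le_div_iff₀ hpos]
      rcases le_or_gt 0 u with h | h
      · rw [abs_of_nonneg h]; nlinarith
      · rw [abs_of_neg h]; nlinarith
    linarith
  · have h1 := Real.log_le_sub_one_of_pos hpos
    have h2 : u ≤ |u| := le_abs_self u
    have h3 := abs_nonneg u
    linarith

/-- `|e^x − 1| ≤ |x| e^{|x|}` for all real `x`. [folklore] -/
theorem abs_exp_sub_one_le (x : ℝ) : |Real.exp x - 1| ≤ |x| * Real.exp |x| := by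
  rcases le_or_gt 0 x with hx | hx
  · have hx1 : 0 ≤ Real.exp x - 1 := by linarith [Real.add_one_le_exp x]
    rw [abs_of_nonneg hx, abs_of_nonneg hx1]
    have h := Real.add_one_le_exp (-x)
    have hpos := Real.exp_pos x
    have h2 : Real.exp x * (-x + 1) ≤ Real.exp x * Real.exp (-x) :=
      mul_le_mul_of_nonneg_left h hpos.le
    rw [← Real.exp_add, add_neg_cancel, Real.exp_zero] at h2
    nlinarith
  · have hx1 : Real.exp x - 1 < 0 := by linarith [Real.exp_lt_one_iff.mpr hx]
    rw [abs_of_neg hx, abs_of_neg hx1]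
    have h := Real.add_one_le_exp x
    have h1 : 1 ≤ Real.exp (-x) := Real.one_le_exp (by linarith)
    nlinarith

/-! ### Euler-factor logarithms and tails of weighted series -/

/-- The logarithm of one Euler factor: if `|g − q| ≤ 1/4` and `1/2 ≤ 1 − q` then
`|log ((1 − g)/(1 − q))| ≤ 4 |g − q|` (write `(1 − g)/(1 − q) = 1 + u`, `u = −(g − q)/(1 − q)`,
`|u| ≤ 2|g − q| ≤ 1/2`, and use `abs_log_one_add_le`). [folklore] -/
theorem abs_log_factor_le {g q : ℝ} (hq : 1 / 2 ≤ 1 - q) (hgq : |g - q| ≤ 1 / 4) :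
    |Real.log ((1 - g) / (1 - q))| ≤ 4 * |g - q| := by
  have hq0 : 0 < 1 - q := by linarith
  set u := -(g - q) / (1 - q) with hu
  have hF : (1 - g) / (1 - q) = 1 + u := by
    have e : 1 - g = (1 - q) + -(g - q) := by ring
    rw [hu, e, add_div, div_self hq0.ne']
  have hule : |u| ≤ 2 * |g - q| := by
    rw [hu, abs_div, abs_neg, abs_of_pos hq0, div_le_iff₀ hq0]
    nlinarith [abs_nonneg (g - q)]
  have hu12 : |u| ≤ 1 / 2 := by linarith
  rw [hF]
  linarith [abs_log_one_add_le hu12]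

/-- Tails of a weighted absolutely convergent series: if `∑ |t n| n^η < ∞` (`η ≥ 0`) then for
`N ≥ 1`, `∑_{n ≥ N} |t n| ≤ N^{−η} ∑' |t n| n^η` and `|∑' t − ∑_{n<N} t n| ≤ N^{−η} ∑' |t n| n^η`.
[folklore] -/
theorem abs_tsum_sub_sum_range_le {t : ℕ → ℝ} {η : ℝ} (hη : 0 ≤ η)
    (hs : Summable fun n => |t n| * (n : ℝ) ^ η) {N : ℕ} (hN : 1 ≤ N) :
    Summable t ∧ |∑' n, t n - ∑ n ∈ Finset.range N, t n| ≤
      (N : ℝ) ^ (-η) * ∑' n, |t n| * (n : ℝ) ^ η := by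
  have hN0 : (0 : ℝ) < N := by exact_mod_cast hN
  have hsN : Summable fun i => |t (i + N)| * ((i + N : ℕ) : ℝ) ^ η :=
    (summable_nat_add_iff N).mpr hs
  have hpt : ∀ i : ℕ, |t (i + N)| ≤ (N : ℝ) ^ (-η) * (|t (i + N)| * ((i + N : ℕ) : ℝ) ^ η) := by
    intro i
    have hiN : (N : ℝ) ≤ ((i + N : ℕ) : ℝ) := by exact_mod_cast Nat.le_add_left N i
    have hle : (1 : ℝ) ≤ (N : ℝ) ^ (-η) * ((i + N : ℕ) : ℝ) ^ η := by
      rw [Real.rpow_neg hN0.le, ← div_eq_inv_mul, one_le_div (Real.rpow_pos_of_pos hN0 η)]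
      exact Real.rpow_le_rpow hN0.le hiN hη
    calc |t (i + N)| = |t (i + N)| * 1 := (mul_one _).symm
      _ ≤ |t (i + N)| * ((N : ℝ) ^ (-η) * ((i + N : ℕ) : ℝ) ^ η) :=
          mul_le_mul_of_nonneg_left hle (abs_nonneg _)
      _ = (N : ℝ) ^ (-η) * (|t (i + N)| * ((i + N : ℕ) : ℝ) ^ η) := by ring
  have hsabs : Summable fun i => |t (i + N)| :=
    (hsN.mul_left ((N : ℝ) ^ (-η))).of_nonneg_of_le (fun i => abs_nonneg _) hpt
  have htabs : Summable fun n => |t n| := (summable_nat_add_iff (f := fun n => |t n|) N).mp hsabs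
  have ht : Summable t := htabs.of_abs
  refine ⟨ht, ?_⟩
  have hsplit := ht.sum_add_tsum_nat_add N
  have hR : ∑' n, t n - ∑ n ∈ Finset.range N, t n = ∑' i, t (i + N) := by
    rw [← hsplit]; ring
  rw [hR]
  have hM : ∑' i, |t (i + N)| * ((i + N : ℕ) : ℝ) ^ η ≤ ∑' n, |t n| * (n : ℝ) ^ η := by
    have hsplit' := hs.sum_add_tsum_nat_add N
    have h0 : 0 ≤ ∑ n ∈ Finset.range N, |t n| * (n : ℝ) ^ η :=
      Finset.sum_nonneg fun n _ => by positivity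
    linarith
  have hnorm : Summable fun i => ‖t (i + N)‖ := hsabs
  have hstep : ‖∑' i, t (i + N)‖ ≤ ∑' i, ‖t (i + N)‖ := norm_tsum_le_tsum_norm hnorm
  simp only [Real.norm_eq_abs] at hstep
  calc |∑' i, t (i + N)| ≤ ∑' i, |t (i + N)| := hstep
    _ ≤ ∑' i, (N : ℝ) ^ (-η) * (|t (i + N)| * ((i + N : ℕ) : ℝ) ^ η) :=
        hsabs.tsum_le_tsum hpt (hsN.mul_left _)
    _ = (N : ℝ) ^ (-η) * ∑' i, |t (i + N)| * ((i + N : ℕ) : ℝ) ^ η := tsum_mul_left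
    _ ≤ (N : ℝ) ^ (-η) * ∑' n, |t n| * (n : ℝ) ^ η :=
        mul_le_mul_of_nonneg_left hM (Real.rpow_nonneg hN0.le _)

/-- Sums over `p < N` prime of a function vanishing off the primes are sums over `range N`.
[folklore] -/
theorem sum_primesBelow_eq_sum_range {t : ℕ → ℝ} (ht : ∀ n, ¬ n.Prime → t n = 0) (N : ℕ) :
    ∑ p ∈ Nat.primesBelow N, t p = ∑ n ∈ Finset.range N, t n := by
  rw [Nat.primesBelow_eq_filter_range, Finset.sum_filter]
  refine Finset.sum_congr rfl fun n _ => ?_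
  by_cases hp : n.Prime
  · rw [if_pos hp]
  · rw [if_neg hp, ht n hp]

/-! ### Rough integers and finite tails -/

/-- Rough integers `δ ≥ 2` are `≥ z`: if `(δ, P(z)) = 1` and `δ ≠ 1`, `δ ≠ 0`, then `z ≤ δ`.
[folklore] -/
theorem le_of_rough {z : ℝ} {δ : ℕ} (hδ0 : δ ≠ 0) (hδ1 : δ ≠ 1)
    (hcop : δ.Coprime (primesProdBelow z)) : z ≤ (δ : ℝ) := by
  have hmf : δ.minFac.Prime := Nat.minFac_prime hδ1
  have hdvd : δ.minFac ∣ δ := Nat.minFac_dvd δ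
  by_contra hlt
  rw [not_le] at hlt
  have hlt' : (δ.minFac : ℝ) < z :=
    lt_of_le_of_lt (by exact_mod_cast Nat.minFac_le (Nat.pos_of_ne_zero hδ0)) hlt
  have h1 : δ.minFac ∣ primesProdBelow z := (dvd_primesProdBelow_iff hmf z).mpr hlt'
  exact hmf.coprime_iff_not_dvd.mp (Nat.Coprime.coprime_dvd_left hdvd hcop) h1

/-- Tail sums over a finite range: if `∑ |t n| n^η < ∞` then for `M ≥ 1` and any finite set `S`
of integers `≥ M`, `∑_{n ∈ S} |t n| ≤ M^{−η} ∑' |t n| n^η`. [folklore] -/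
theorem sum_abs_le_of_le_mem {t : ℕ → ℝ} {η : ℝ} (hη : 0 ≤ η)
    (hs : Summable fun n => |t n| * (n : ℝ) ^ η) {M : ℕ} (hM : 1 ≤ M) {S : Finset ℕ}
    (hS : ∀ n ∈ S, M ≤ n) :
    ∑ n ∈ S, |t n| ≤ (M : ℝ) ^ (-η) * ∑' n, |t n| * (n : ℝ) ^ η := by
  have hM0 : (0 : ℝ) < M := by exact_mod_cast hM
  have hpt : ∀ n ∈ S, |t n| ≤ (M : ℝ) ^ (-η) * (|t n| * (n : ℝ) ^ η) := by
    intro n hn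
    have hMn : (M : ℝ) ≤ n := by exact_mod_cast hS n hn
    have hle : (1 : ℝ) ≤ (M : ℝ) ^ (-η) * (n : ℝ) ^ η := by
      rw [Real.rpow_neg hM0.le, ← div_eq_inv_mul, one_le_div (Real.rpow_pos_of_pos hM0 η)]
      exact Real.rpow_le_rpow hM0.le hMn hη
    calc |t n| = |t n| * 1 := (mul_one _).symm
      _ ≤ |t n| * ((M : ℝ) ^ (-η) * (n : ℝ) ^ η) := mul_le_mul_of_nonneg_left hle (abs_nonneg _)
      _ = (M : ℝ) ^ (-η) * (|t n| * (n : ℝ) ^ η) := by ring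
  calc ∑ n ∈ S, |t n| ≤ ∑ n ∈ S, (M : ℝ) ^ (-η) * (|t n| * (n : ℝ) ^ η) := Finset.sum_le_sum hpt
    _ = (M : ℝ) ^ (-η) * ∑ n ∈ S, |t n| * (n : ℝ) ^ η := (Finset.mul_sum _ _ _).symm
    _ ≤ (M : ℝ) ^ (-η) * ∑' n, |t n| * (n : ℝ) ^ η :=
        mul_le_mul_of_nonneg_left (hs.sum_le_tsum S fun n _ => by positivity)
          (Real.rpow_nonneg hM0.le _)

end BombieriSieve

end Literature.NumberTheory.Sieve
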